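import Literature.NumberTheory.IwasawaTheory.ClassGroupPRankLeOfRelationCoinvariant
import Literature.NumberTheory.NumberFields.GenusCoinvariantCyclicOfTwoRamified
import Literature.NumberTheory.NumberFields.AmbiguousClassGenusLowerBound
import HarnessLib

/-!
# THE RELATION DOOR WITHOUT CHEVALLEY: in a `ℤ_p`-tower over `K` with `p ∤ h_K` and at most TWO ramified primes (one totally ramified in `K_n`),
# ONE relation `∏ σ^i(c)^{f_i} = 1` on a class `c ∉ Cl^{σ−1}·Cl^p` with `∑ f_i X^i = (X−1)^d·u + p·g`, `p ∤ u(1)` ⟹ `rank_p Cl(K_n) ≤ d`;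
# with Fukuda index `0` and `d + 2 ≤ p^n`: `μ = 0`, `λ ≤ d`, all ranks `≤ d` — for EVERY unit depth `t`

Topic `NumberTheory/IwasawaTheory` (namespace = path).  THEOREMS ONLY (no definition, no named fact, no instance, no `sorry`); unconditional.  Written by the prover seat
`bsd-line-att-p3` g49 (cell `bsd-f1-sign2`, WIDTH-5 attach on route `AlignedTransportAtTwo`, crux C2 stmt-BirchSwinnertonDyer-22298; `--supports`, closes nothing).
Assembly of this seat's `ClassGroupPRankLeOfRelationCoinvariant` (the door with the coinvariant index `[Cl(K_n) : Cl^p·⟨σx·x⁻¹⟩] ≤ p` displayed) and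
`NumberFields/GenusCoinvariantCyclicOfTwoRamified` (GENUS CYCLICITY: that index IS `≤ p` whenever `Gal(K_n/K)` is cyclic of `p`-power order, `K_n/K` is unramified at
infinity, `p ∤ h_K`, every prime of `K_n` outside two primes `P₁, P₂` of `K` is unramified and the primes above `P₁` are totally ramified).  Compared with att-p3 g48's
`ClassGroupPRankLeOfRelation` the CHEVALLEY hypothesis `p² ∤ #Cl(K_n)^{Gal}` is GONE: over the cell's bases (`K = ℚ(β)` complex cubic, `h_K` odd, `2 = 𝔭₁𝔭₂`) the door
now fires for every `2`-adic unit depth `t` — in particular on the converse quadrant `t ≥ 4 ∧ e₁ ≥ 2` (`N = 1187, 4307, 13971, 14539`), from the same certificate type as the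
hard core: the genus certificate for `c` and ONE principal generator.

* `closure_smul_div_le_closure_of_mem_zpowers` — for `Gal(K_n/K) = ⟨σ⟩`: `⟨τc·c⁻¹ : τ, c⟩ ≤ ⟨σx·x⁻¹ : x⟩` (telescoping, tree `AmbiguousClass.smul_div_mem_range_of_mem_zpowers`).
* ★★★ `classGroupPRank_le_of_relation_of_two_ramified` — one layer: `rank_p Cl(K_n) ≤ d`.
* ★★★ `classicalMuVanishes_and_classicalLambda_le_of_relation_of_two_ramified` — Fukuda index `0`, `d + 2 ≤ p^n` ⟹ `rank_p Cl(K_m) ≤ d ∀ m`, `μ = 0`, `λ ≤ d`;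
  `…_index_of_two_ramified` — Fukuda index `n₀`, layer `n₀ + j`, `d + 2 ≤ p^j` ⟹ the same for `m ≥ n₀` (appended, same gen).

HONEST SCOPE: classical (Washington §13.3 at finite level + genus theory); nothing specific to any summit; no certificate for any field is asserted; BSD is not advanced by this
file.  The `p = 2` cubic specialisation (the two dyadic primes of `ℚ(β)`, total ramification from `2 ∤ d_K`) is left to the `W`-level glue.

## References

* L. C. Washington, *Introduction to Cyclotomic Fields*, 2nd ed. (1997), §13.3 Lemmas 13.15, 13.18, Prop. 13.22–13.23. [Washington1997]
* G. Gras, *Class Field Theory* (2003), IV.4. [Gras2003]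
* T. Fukuda, *Remarks on `ℤ_p`-extensions of number fields*, Proc. Japan Acad. 70 A (1994), Thm. 1. [Fukuda1994]
* S. Lang, *Cyclotomic Fields I and II* (1990), Ch. 13 §4 Lemma 4.1. [Lang1990]
-/

set_option autoImplicit false

noncomputable section

open Polynomial Finset

namespace Literature.NumberTheory.IwasawaTheory

open scoped NumberField
open NumberField Field Literature.NumberTheory.EllipticCurves Literature.NumberTheory.NumberFields
  Literature.NumberTheory.GaloisRepresentations

section Door

variable {K : Type} [Field K] [NumberField K] {p : ℕ} [hp : Fact p.Prime]

omit [NumberField K] in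
/-- For `Gal(L/K) = ⟨σ⟩`: the subgroup generated by all `τc·c⁻¹` is contained in the one generated by the `σx·x⁻¹` (`σ^k c/c = ∏_{i<k} σ(σ^i c)/(σ^i c)`).
[cite: Washington1997, §13.3 Lemma 13.18] -/
theorem closure_smul_div_le_closure_of_mem_zpowers {L : Type} [Field L] [NumberField L] [Algebra K L] [FiniteDimensional K L]
    {σ : L ≃ₐ[K] L} (hσ : ∀ τ : L ≃ₐ[K] L, τ ∈ Subgroup.zpowers σ) :
    Subgroup.closure {x | ∃ (τ : L ≃ₐ[K] L) (c : ClassGroup (𝓞 L)), x = ClassGroup.mulEquiv (AmbiguousClass.intAut τ) c * c⁻¹} ≤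
      Subgroup.closure {x | ∃ x' : ClassGroup (𝓞 L), x = ClassGroup.mulEquiv (AmbiguousClass.intAut σ) x' * x'⁻¹} := by
  rw [Subgroup.closure_le]
  rintro _ ⟨τ, c, rfl⟩
  obtain ⟨y, hy⟩ := AmbiguousClass.smul_div_mem_range_of_mem_zpowers hσ τ c
  rw [SetLike.mem_coe, ← hy, MonoidHom.div_apply, MonoidHom.id_apply, MulEquiv.coe_toMonoidHom, div_eq_mul_inv]
  exact Subgroup.subset_closure ⟨y, rfl⟩

/-- ★★★ **THE RELATION DOOR WITHOUT CHEVALLEY (one layer).**  `κ` a `ℤ_p`-extension of `K` with **`p ∤ h_K`**, a layer `n`, `σ` a generator of `Gal(K_n/K)`; maximal ideals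
`P₁, P₂ ⊂ 𝓞_K` such that every maximal ideal of `𝓞_{K_n}` above neither is unramified over `K` and those above `P₁` have ramification index `[K_n : K]`; a class `c` **not of
the form `σ(b)·b⁻¹·e^p`**; ONE RELATION `∏_{i<N} σ^i(c)^{f_i} = 1` with `∑ f_i X^i = (X−1)^d·u + p·g`, `p ∤ u(1)`.  THEN **`rank_p Cl(K_n) ≤ d`** (genus cyclicity
supplies the coinvariant index `≤ p`). [cite: Washington1997, §13.3 Lemmas 13.15, 13.18, Prop. 13.22–13.23] [cite: Gras2003, IV.4] [cite: Lang1990, Ch. 13 §4 Lemma 4.1] -/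
theorem classGroupPRank_le_of_relation_of_two_ramified (κ : ZpExtension K p) (hh : ¬ p ∣ classNumber K) (n : ℕ)
    (P₁ P₂ : Ideal (𝓞 K)) [P₁.IsMaximal] [P₂.IsMaximal]
    (hram : ∀ (q : Ideal (𝓞 (κ.layer n))) [q.IsMaximal], q.under (𝓞 K) ≠ P₁ → q.under (𝓞 K) ≠ P₂ → Algebra.IsUnramifiedAt (𝓞 K) q)
    (htot : ∀ (q : Ideal (𝓞 (κ.layer n))) [q.IsMaximal], q.under (𝓞 K) = P₁ → q.ramificationIdx (𝓞 K) = Module.finrank K (κ.layer n))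
    (σ : (κ.layer n) ≃ₐ[K] (κ.layer n)) (hσ : ∀ τ : (κ.layer n) ≃ₐ[K] (κ.layer n), τ ∈ Subgroup.zpowers σ)
    {c : ClassGroup (𝓞 (κ.layer n))}
    (hc : ¬ ∃ b e : ClassGroup (𝓞 (κ.layer n)), c = ClassGroup.mulEquiv (AmbiguousClass.intAut σ) b / b * e ^ p)
    {N d : ℕ} {f : ℕ → ℤ} {u g : ℤ[X]} (hu : ¬ (p : ℤ) ∣ u.eval 1)
    (hF : (∑ i ∈ range N, C (f i) * X ^ i : ℤ[X]) = (X - 1) ^ d * u + C (p : ℤ) * g)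
    (hrel : ∏ i ∈ range N, (ClassGroup.mulEquiv (AmbiguousClass.intAut (σ ^ i)) c) ^ (f i) = 1) :
    classGroupPRank κ n ≤ d := by
  classical
  haveI : FiniteDimensional K (κ.layer n) := κ.finiteDimensional_layer_holds n
  haveI : NumberField (κ.layer n) := NumberField.of_module_finite K _
  haveI : IsGalois K (κ.layer n) := κ.isGalois_layer_holds n
  haveI : IsUnramifiedAtInfinitePlaces K (κ.layer n) := κ.isUnramifiedAtInfinitePlaces_layer n
  obtain ⟨ψ, -, hker, -⟩ := κ.exists_cyclicCharacter_layer n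
  have hcyc : IsCyclic ((κ.layer n) ≃ₐ[K] (κ.layer n)) := isCyclic_of_cyclicLayer ψ (κ.layer n) hker
  have hdeg : ∃ m : ℕ, Module.finrank K (κ.layer n) = p ^ m := ⟨n, κ.finrank_layer_holds n⟩
  have hh' : ¬ p ∣ Fintype.card (ClassGroup (𝓞 K)) := hh
  have hidx := index_pow_sup_closure_le_of_two_ramified hcyc hdeg hh' P₁ P₂ hram htot
  have hle : (powMonoidHom p : ClassGroup (𝓞 (κ.layer n)) →* ClassGroup (𝓞 (κ.layer n))).range ⊔
      Subgroup.closure {x | ∃ (τ : (κ.layer n) ≃ₐ[K] (κ.layer n)) (c : ClassGroup (𝓞 (κ.layer n))),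
        x = ClassGroup.mulEquiv (AmbiguousClass.intAut τ) c * c⁻¹} ≤
      (powMonoidHom p : ClassGroup (𝓞 (κ.layer n)) →* ClassGroup (𝓞 (κ.layer n))).range ⊔
      Subgroup.closure {x | ∃ x' : ClassGroup (𝓞 (κ.layer n)), x = ClassGroup.mulEquiv (AmbiguousClass.intAut σ) x' * x'⁻¹} :=
    sup_le_sup_left (closure_smul_div_le_closure_of_mem_zpowers hσ) _
  have hcoinv := (Nat.le_of_dvd (Nat.pos_of_ne_zero Subgroup.index_ne_zero_of_finite) (Subgroup.index_dvd_of_le hle)).trans hidx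
  exact classGroupPRank_le_of_relation_of_index_le κ n σ hcoinv hc hu hF hrel

/-- ★★★ **THE RELATION DOOR WITHOUT CHEVALLEY (every layer, `μ = 0`, `λ ≤ d`).**  As `classGroupPRank_le_of_relation_of_two_ramified` with Fukuda index `0`
(`TotallyRamifiedFrom κ 0`) and **`d + 2 ≤ p^n`**: THEN **`rank_p Cl(K_m) ≤ d` for every `m`, `μ(κ) = 0`, `λ(κ) ≤ d`** — no hypothesis on the ambiguous class number, i.e.
no hypothesis on the unit depth `t` of the base. [cite: Washington1997, §13.3 Prop. 13.22–13.23] [cite: Fukuda1994, Thm. 1, p. 264] [cite: Gras2003, IV.4] -/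
theorem classicalMuVanishes_and_classicalLambda_le_of_relation_of_two_ramified (κ : ZpExtension K p) (hκ : TotallyRamifiedFrom κ 0)
    (hh : ¬ p ∣ classNumber K) {n : ℕ} (P₁ P₂ : Ideal (𝓞 K)) [P₁.IsMaximal] [P₂.IsMaximal]
    (hram : ∀ (q : Ideal (𝓞 (κ.layer n))) [q.IsMaximal], q.under (𝓞 K) ≠ P₁ → q.under (𝓞 K) ≠ P₂ → Algebra.IsUnramifiedAt (𝓞 K) q)
    (htot : ∀ (q : Ideal (𝓞 (κ.layer n))) [q.IsMaximal], q.under (𝓞 K) = P₁ → q.ramificationIdx (𝓞 K) = Module.finrank K (κ.layer n))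
    (σ : (κ.layer n) ≃ₐ[K] (κ.layer n)) (hσ : ∀ τ : (κ.layer n) ≃ₐ[K] (κ.layer n), τ ∈ Subgroup.zpowers σ)
    {c : ClassGroup (𝓞 (κ.layer n))}
    (hc : ¬ ∃ b e : ClassGroup (𝓞 (κ.layer n)), c = ClassGroup.mulEquiv (AmbiguousClass.intAut σ) b / b * e ^ p)
    {N d : ℕ} (hd : d + 2 ≤ p ^ n) {f : ℕ → ℤ} {u g : ℤ[X]} (hu : ¬ (p : ℤ) ∣ u.eval 1)
    (hF : (∑ i ∈ range N, C (f i) * X ^ i : ℤ[X]) = (X - 1) ^ d * u + C (p : ℤ) * g)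
    (hrel : ∏ i ∈ range N, (ClassGroup.mulEquiv (AmbiguousClass.intAut (σ ^ i)) c) ^ (f i) = 1) :
    (∀ m, classGroupPRank κ m ≤ d) ∧ ClassicalMuVanishes κ ∧ classicalLambda κ ≤ d := by
  have hn := classGroupPRank_le_of_relation_of_two_ramified κ hh n P₁ P₂ hram htot σ hσ hc hu hF hrel
  have hsmall : classGroupPRank κ (0 + n) < p ^ n - 1 := by rw [Nat.zero_add]; omega
  have hall : ∀ m, classGroupPRank κ m ≤ d := fun m => by
    have h := classGroupPRank_le_of_lt_pow_sub_one κ hκ le_rfl hsmall m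
    rw [Nat.zero_add, Nat.zero_add] at h
    exact h.trans hn
  exact ⟨hall, classicalLambda_le_of_forall_classGroupPRank_le κ hκ (n := 0) le_rfl (B := d) fun m _ => hall m⟩

/-- ★★★ **THE RELATION DOOR WITHOUT CHEVALLEY, Fukuda index `n₀` (every layer `≥ n₀`, `μ = 0`, `λ ≤ d`).**  `κ` a `ℤ_p`-extension totally ramified at every ramified prime
from layer `n₀` (`TotallyRamifiedFrom κ n₀`), `p ∤ h_K`, a layer `n₀ + j` with **`d + 2 ≤ p^j`**, maximal `P₁, P₂ ⊂ 𝓞_K` with every prime of `𝓞_{K_{n₀+j}}` above neither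
unramified and those above `P₁` of index `[K_{n₀+j} : K]`, `σ` generating, the generator certificate and ONE relation of order `d`.  THEN **`rank_p Cl(K_m) ≤ d` for every
`m ≥ n₀`, `μ(κ) = 0`, `λ(κ) ≤ d`**.  (Habitat: bases where the second ramified prime enters the tower later, e.g. a dyadic prime with `K_𝔭 = ℚ₂(√2)`; `P₁` must still be
totally ramified in `K_{n₀+j}/K`.) [cite: Washington1997, §13.3 Prop. 13.22–13.23] [cite: Fukuda1994, Thm. 1, p. 264] [cite: Gras2003, IV.4] -/
theorem classicalMuVanishes_and_classicalLambda_le_of_relation_index_of_two_ramified (κ : ZpExtension K p) {n₀ : ℕ} (hκ : TotallyRamifiedFrom κ n₀)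
    (hh : ¬ p ∣ classNumber K) {j : ℕ} (P₁ P₂ : Ideal (𝓞 K)) [P₁.IsMaximal] [P₂.IsMaximal]
    (hram : ∀ (q : Ideal (𝓞 (κ.layer (n₀ + j)))) [q.IsMaximal], q.under (𝓞 K) ≠ P₁ → q.under (𝓞 K) ≠ P₂ → Algebra.IsUnramifiedAt (𝓞 K) q)
    (htot : ∀ (q : Ideal (𝓞 (κ.layer (n₀ + j)))) [q.IsMaximal], q.under (𝓞 K) = P₁ →
      q.ramificationIdx (𝓞 K) = Module.finrank K (κ.layer (n₀ + j)))
    (σ : (κ.layer (n₀ + j)) ≃ₐ[K] (κ.layer (n₀ + j))) (hσ : ∀ τ : (κ.layer (n₀ + j)) ≃ₐ[K] (κ.layer (n₀ + j)), τ ∈ Subgroup.zpowers σ)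
    {c : ClassGroup (𝓞 (κ.layer (n₀ + j)))}
    (hc : ¬ ∃ b e : ClassGroup (𝓞 (κ.layer (n₀ + j))), c = ClassGroup.mulEquiv (AmbiguousClass.intAut σ) b / b * e ^ p)
    {N d : ℕ} (hd : d + 2 ≤ p ^ j) {f : ℕ → ℤ} {u g : ℤ[X]} (hu : ¬ (p : ℤ) ∣ u.eval 1)
    (hF : (∑ i ∈ range N, C (f i) * X ^ i : ℤ[X]) = (X - 1) ^ d * u + C (p : ℤ) * g)
    (hrel : ∏ i ∈ range N, (ClassGroup.mulEquiv (AmbiguousClass.intAut (σ ^ i)) c) ^ (f i) = 1) :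
    (∀ m, n₀ ≤ m → classGroupPRank κ m ≤ d) ∧ ClassicalMuVanishes κ ∧ classicalLambda κ ≤ d := by
  have hn := classGroupPRank_le_of_relation_of_two_ramified κ hh (n₀ + j) P₁ P₂ hram htot σ hσ hc hu hF hrel
  have hsmall : classGroupPRank κ (n₀ + j) < p ^ j - 1 := by omega
  have hall : ∀ m, n₀ ≤ m → classGroupPRank κ m ≤ d := fun m hm => by
    obtain ⟨k, rfl⟩ : ∃ k, m = n₀ + k := ⟨m - n₀, by omega⟩
    exact (classGroupPRank_le_of_lt_pow_sub_one κ hκ le_rfl hsmall k).trans hn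
  exact ⟨hall, classicalLambda_le_of_forall_classGroupPRank_le κ hκ (n := n₀) le_rfl (B := d) hall⟩

end Door

end Literature.NumberTheory.IwasawaTheory

end
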